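import Literature.NumberTheory.Transcendental.KZLogCalculusProofs
import Literature.NumberTheory.Transcendental.KZDominatedFamilyRelations
import Literature.NumberTheory.Transcendental.EllIterRep
import Summits.KontsevichZagierPeriods.KontsevichZagierPeriods.Theorems.NormalFormPrinciple.Negative.WindowInvariant

/-!
# `NormalFormPrinciple` (stmt-KontsevichZagierPeriods-3869), line `SketchIdeator1` — registered stub
# `slabA_sub_pt_mem_relations`: Newton–Leibniz over the point with ALGEBRAIC ends

Pure proof file (`--supports` the crux; siege attempt k24 on the registered sub-goal
`slabA_sub_pt_mem_relations` of the algebraic-pole layer of the leaf `stub_boxRigidity`).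

The move: let `α ≤ β` be real algebraic numbers, `N = [(α,β), f]` an interval representation whose
integrand `x ↦ f(x₀)` is `ℚ`-semialgebraic on the closed slab `{α ≤ x₀ ≤ β}`, and `F` an abstract
primitive of `f` on `(α,β)` — `ℚ`-semialgebraic (read on the first coordinate) on the closed slab,
continuous on `[α,β]`. Then `[N] − [pt, F(β) − F(α)] ∈ relations` for every point representation
`[pt, F(β) − F(α)]` over `ℝ⁰`. Proof: ONE Newton–Leibniz move (rule 3) from the closed slab
`R = [[α,β], f]` to the point (fibre bounds the algebraic constants `α`, `β`, primitive `z ↦ F(z₀)`),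
then rule 1a across the two null endpoints `{x₀ = α}`, `{x₀ = β}` and congruence with `N`.
This is `slab_sub_pt_mem_relations` (`…SplitMoves.lean`, rational ends, rational primitive) with the
arithmetic of the data relaxed to what rules 1–3 actually ask.

Sources: M. Kontsevich, D. Zagier, *Periods* (2001), §1.2 rules (1), (3). No definitions are introduced.
-/

noncomputable section

open MeasureTheory Set
open Literature.NumberTheory.Transcendental Literature.NumberTheory.Transcendental.KZ
open Literature.ModelTheory.ExponentialFields (IsSemialgebraic isSemialgebraic_univ)

namespace Summit.KontsevichZagierPeriods.HurwitzMicroSectors.NormalFormPrinciple.PiBox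

namespace SlabA

open Summit.KontsevichZagierPeriods.HurwitzMicroSectors.NormalFormPrinciple.Negative
  (integrableOn_fin_one)

/-! ## Slabs with algebraic ends -/

/-- The closed slab `{α ≤ x₀ ≤ β} ⊂ ℝ¹` with real algebraic ends is `ℚ`-semialgebraic
(complements of the two open half-lines). [cite: BochnakCosteRoy1998, §2.1] -/
theorem isSemialgebraic_setOf_apply_mem_Icc {α β : ℝ} (hα : IsAlgebraic ℚ α) (hβ : IsAlgebraic ℚ β) :
    IsSemialgebraic ℚ {x : Fin 1 → ℝ | x 0 ∈ Set.Icc α β} := by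
  have h : {x : Fin 1 → ℝ | x 0 ∈ Set.Icc α β} =
      {x : Fin 1 → ℝ | x 0 < α}ᶜ ∩ {x : Fin 1 → ℝ | β < x 0}ᶜ := by
    ext x
    simp [not_lt]
  rw [h]
  exact (isSemialgebraic_setOf_apply_lt_const hα 0).compl.inter
    (isSemialgebraic_setOf_const_lt_apply hβ 0).compl

/-- The open slab `{α < x₀ < β} ⊂ ℝ¹` with real algebraic ends is `ℚ`-semialgebraic.
[cite: BochnakCosteRoy1998, §2.1] -/
theorem isSemialgebraic_setOf_apply_mem_Ioo {α β : ℝ} (hα : IsAlgebraic ℚ α) (hβ : IsAlgebraic ℚ β) :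
    IsSemialgebraic ℚ {x : Fin 1 → ℝ | x 0 ∈ Set.Ioo α β} := by
  have h : {x : Fin 1 → ℝ | x 0 ∈ Set.Ioo α β} = {x : Fin 1 → ℝ | α < x 0} ∩ {x | x 0 < β} := by
    ext x
    simp
  rw [h]
  exact (isSemialgebraic_setOf_const_lt_apply hα 0).inter (isSemialgebraic_setOf_apply_lt_const hβ 0)

/-! ## The Newton–Leibniz move over the point -/

/-- **Newton–Leibniz over the point, algebraic ends, abstract primitive** (rule 3, plus the null
endpoints, rule 1a). Let `α ≤ β` be real algebraic, `N = [(α,β), f]` an interval representation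
whose integrand `x ↦ f(x₀)` is `ℚ`-semialgebraic on the closed slab, and `F` a primitive of `f` on
`(α,β)` which, read on the first coordinate, is `ℚ`-semialgebraic on the closed slab and continuous
on `[α,β]`. Then `[N] − [pt, F(β) − F(α)] ∈ relations` for every point representation with that
constant. [cite: KontsevichZagier2001, §1.2 rule (3)] -/
theorem slabA_sub_pt_mem_relations {α β : ℝ} (hα : IsAlgebraic ℚ α) (hβ : IsAlgebraic ℚ β)
    (hαβ : α ≤ β) (f F : ℝ → ℝ)
    (hF : IsSemialgebraicFunOn ℚ {x : Fin 1 → ℝ | x 0 ∈ Set.Icc α β} (fun x => F (x 0)))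
    (hFc : ContinuousOn F (Set.Icc α β))
    (hderiv : ∀ t ∈ Set.Ioo α β, HasDerivAt F (f t) t)
    (hf : IsSemialgebraicFunOn ℚ {x : Fin 1 → ℝ | x 0 ∈ Set.Icc α β} (fun x => f (x 0)))
    (N : IntegralRep 1) (hNd : N.domain = {x | x 0 ∈ Set.Ioo α β})
    (hNi : EqOn N.integrand (fun x => f (x 0)) N.domain)
    (Z : IntegralRep 0) (hZd : Z.domain = univ) (hZi : Z.integrand = fun _ => F β - F α) :
    of N - of Z ∈ relations := by
  set C : Set (Fin 1 → ℝ) := {x | x 0 ∈ Set.Icc α β} with hC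
  have hCsa : IsSemialgebraic ℚ C := isSemialgebraic_setOf_apply_mem_Icc hα hβ
  have hIoo : IsSemialgebraic ℚ {x : Fin 1 → ℝ | x 0 ∈ Set.Ioo α β} :=
    isSemialgebraic_setOf_apply_mem_Ioo hα hβ
  -- the integrand `f` on the closed slab is integrable (it is `N.integrand` a.e.)
  have hfi : IntegrableOn (fun x : Fin 1 → ℝ => f (x 0)) C := by
    have h1 : IntegrableOn (fun x : Fin 1 → ℝ => f (x 0)) N.domain :=
      N.integrableOn.congr_fun hNi (IsSemialgebraic.measurableSet_holds N.isSemialgebraic_domain)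
    rw [hNd, integrableOn_fin_one] at h1
    rw [hC, integrableOn_fin_one]
    exact h1.congr_set_ae (Ioo_ae_eq_Icc (a := α) (b := β)).symm
  -- the closed-slab representation `R = [[α,β], f]`
  obtain ⟨R, hRd, hRi⟩ : ∃ R : IntegralRep 1, R.domain = C ∧ R.integrand = fun x => f (x 0) :=
    ⟨⟨C, fun x => f (x 0), hCsa, hf, hfi⟩, rfl, rfl⟩
  have hs0 : ∀ (x : Fin 0 → ℝ) (t : ℝ), (Fin.snoc x t : Fin 1 → ℝ) 0 = t := fun _ _ => rfl
  -- (i) ONE Newton–Leibniz move over `ℝ⁰`: `[R] − [Z] ∈ newtonLeibnizRel`, primitive `F (z 0)`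
  have hNL : of R - of Z ∈ newtonLeibnizRel := by
    refine ⟨0, R, Z, fun _ => α, fun _ => β, fun z => F (z 0), ?_, ?_, ?_,
      fun _ _ => hαβ, ?_, ?_, ?_, ?_, rfl⟩
    · rw [hRd]
      exact hF
    · rw [hZd]
      exact isSemialgebraicFunOn_const_of_isAlgebraic isSemialgebraic_univ hα
    · rw [hZd]
      exact isSemialgebraicFunOn_const_of_isAlgebraic isSemialgebraic_univ hβ
    · rw [hRd, hZd, hC]
      ext z
      simp only [Set.mem_setOf_eq, Set.mem_Icc, Set.mem_univ, true_and]
      rfl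
    · -- continuity of `t ↦ F t` on the closed fibre
      intro x _
      simpa only [hs0] using hFc
    · -- derivative on the open fibre
      intro x _ t ht
      rw [hRi]
      simpa only [hs0] using hderiv t ht
    · intro x _
      simp only [hZi, hs0]
  -- (ii) closed slab versus the open slab `N.domain` (null endpoints), and congruence with `N`
  have hEsub : {x : Fin 1 → ℝ | x 0 ∈ Set.Ioo α β} ⊆ R.domain := by
    rw [hRd, hC]
    exact fun x hx => Set.Ioo_subset_Icc_self hx
  have hnull : volume (R.domain \ {x : Fin 1 → ℝ | x 0 ∈ Set.Ioo α β}) = 0 := by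
    have hα0 : volume {w : Fin 1 → ℝ | w 0 = α} = 0 := by
      rw [volume_pi]
      exact Measure.pi_hyperplane _ _ _
    have hβ0 : volume {w : Fin 1 → ℝ | w 0 = β} = 0 := by
      rw [volume_pi]
      exact Measure.pi_hyperplane _ _ _
    refine measure_mono_null (fun x hx => ?_) (measure_union_null hα0 hβ0)
    rw [hRd, hC] at hx
    obtain ⟨⟨h1, h2⟩, h3⟩ := hx
    simp only [Set.mem_setOf_eq, Set.mem_Ioo, not_and, not_lt] at h3
    simp only [Set.mem_union, Set.mem_setOf_eq]
    rcases h1.lt_or_eq with h1 | h1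
    · exact Or.inr (le_antisymm h2 (h3 h1))
    · exact Or.inl h1.symm
  have h2 : of R - of (R.restrict _ hIoo hEsub) ∈ relations :=
    R.of_sub_of_restrict_mem_relations hIoo hEsub hnull
  have h3 : of (R.restrict _ hIoo hEsub) - of N ∈ relations :=
    of_sub_of_mem_relations_of_eqOn (by rw [hNd]; rfl) fun x hx => by
      rw [IntegralRep.integrand_restrict, hRi, hNi (by rw [hNd]; exact hx)]
  have : of N - of Z = (of R - of Z) - (of R - of (R.restrict _ hIoo hEsub)) -
      (of (R.restrict _ hIoo hEsub) - of N) := by abel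
  rw [this]
  exact relations.sub_mem (relations.sub_mem (newtonLeibnizRel_subset_relations hNL) h2) h3

end SlabA

end Summit.KontsevichZagierPeriods.HurwitzMicroSectors.NormalFormPrinciple.PiBox
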